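import Summits.CriticalPhenomena.PercolationContinuityZ3.Theorems.PercNearOneGluingNoHeavyLowerTailKnQuestion8CoefficientwiseRootPointFlipHalfSector
import HarnessLib

/-!
# The HALF point row (`1_u × any monotone g`) with the point `u` at a root of degree two, II: THEOREM R42-HALF (prim-lf-2 gen 42)

Support file (`--supports stmt-CriticalPhenomena-4575`, closed), prover `prim-lf-2` (gen 42).  No definitions, no named facts, no sorries; standard axioms.
Memo `prim-lf-2/CW-ROOTFLIP-gen42.md` §1.3; companions `…CoefficientwiseRootPointFlip` (THEOREM R42 = the point entries `g = 1_w`, and the relative blue-cluster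
flip lemmas reused here) and `…CoefficientwiseRootPointFlipHalfSector` (the sector identity `halfRow_rootDegTwo_eq`).

Setting (CW-POINTS-gen32, CW-LOCALITY-gen33): multigraph `ends : ι → Sym2 V` on an edge set `E`, root `x`, wall set `Z ∌ x`, colourings `s ⊔ (E∖s)`, red / blue clusters
`C_x(s)`, `C_x(E∖s)`, `σ_u = 1[u ∈ C_x s] − 1[u ∈ C_x(E∖s)]`, `Δg = g(C_x s) − g(C_x(E∖s))`.  The HALF POINT ROW (the row `f = 1_u` of CW-PA) is the conjecture
`0 ≤ Σ_{W_E} σ_u Δg` for every monotone `g : Set V → ℝ` (gen 33; proved there when `|N(z) ∖ {u,w}| ≤ 1`).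
* `Coefficientwise.halfPointRow_nonneg_of_rootAdjPoint` — **THEOREM R42-HALF**: if the only edges at `x` are `e₁ = {x,u}`, `e₂ = {x,q}` (`q` arbitrary) then
  `0 ≤ Σ_{W_E} σ_u Δg` for EVERY monotone `g` and every wall set `Z ∌ x`.  Proof: with `p = u` the pure terms are `G(t) = g({x} ∪ C_u t ∪ C_q t) − g{x} ≥ 0` and the
  mixed terms are `(1 − 1[u ∈ B])(g({x} ∪ C_u t) − g({x} ∪ B)) ≥ −1[u ∉ B]·(g({x} ∪ B) − g{x})`, `B = C_q(E'∖t)`; the blue-cluster flip `φ` is injective on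
  `{u ∉ B}`, lands in the pure wall set and has `{x} ∪ B ⊆ {x} ∪ C_u(φt) ∪ C_q(φt)`, so the negative part is dominated by distinct pure terms (monotonicity of `g`).
  The point case `g = 1[w ∈ ·]` is THEOREM R42; this is the whole `u`-row of CW-PA for the class 'a point at a simple degree-two root'.
[cite: KozmaNitzan2024, Questions 8–9 (§5.5 p. 36) (context: the Question-8 pocket covariance programme; the argument is an elementary injection)]
-/

namespace Summit.CriticalPhenomena.PercolationContinuityZ3.Theorems

open Finset Literature.Probability.Percolation
open scoped symmDiff

namespace Coefficientwise

variable {ι V : Type*} (ends : ι → Sym2 V)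

section main

variable [DecidableEq ι]

open Classical in
/-- **THEOREM R42-HALF (prim-lf-2 gen 42): the half point row `Σ_W σ_u Δg ≥ 0` for every monotone `g` when `u` sits at a simple degree-two root.**
Let the only edges of `E` at `x` be `e₁ ≠ e₂` with ends `{x,u}`, `{x,q}` (`q` arbitrary), `u ≠ x`, `Z ∌ x` a wall set and `g : Set V → ℝ` monotone.  Then
`0 ≤ Σ_{s ⊆ E : Z ∩ (C_x s ∪ C_x(E∖s)) = ∅} (1[u ∈ C_x s] − 1[u ∈ C_x(E∖s)])·(g(C_x s) − g(C_x(E∖s)))`.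
Proof: `halfRow_rootDegTwo_eq` with `p = u`; pure terms `G(t) = g({x} ∪ C_u t ∪ C_q t) − g{x} ≥ 0`; mixed terms `≥ −1[u ∉ B]·(g({x} ∪ B) − g{x})`, `B = C_q(E'∖t)`;
the blue-cluster flip `φ` (`openCluster_relFlip`, `openCluster_relFlip_subset`, `relFlip_relFlip`) is injective on `{u ∉ B}`, maps into the pure wall set, and
`{x} ∪ B ⊆ {x} ∪ C_u(φt) ∪ C_q(φt)`, so `Σ 1[u ∉ B](g({x} ∪ B) − g{x}) ≤ Σ_{image} G ≤ Σ_{pure} G`.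
[cite: KozmaNitzan2024, Questions 8–9 (§5.5 p. 36) (context; the argument is an elementary injection)] -/
theorem halfPointRow_nonneg_of_rootAdjPoint (E : Finset ι) {x u q : V} {e₁ e₂ : ι} (he₁ : e₁ ∈ E) (he₂ : e₂ ∈ E) (hne : e₁ ≠ e₂)
    (h₁ : ends e₁ = s(x, u)) (h₂ : ends e₂ = s(x, q)) (hroot : ∀ i ∈ E, x ∈ ends i → i = e₁ ∨ i = e₂)
    (hux : u ≠ x) (Z : Set V) (hxZ : x ∉ Z) (g : Set V → ℝ) (hg : Monotone g) :
    0 ≤ ∑ s ∈ E.powerset.filter (fun s : Finset ι => ∀ z ∈ Z, z ∉ openCluster (ends '' (↑(s) : Set ι)) x ∧ z ∉ openCluster (ends '' (↑(E \ s) : Set ι)) x),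
      ((if u ∈ openCluster (ends '' (↑(s) : Set ι)) x then (1 : ℝ) else 0) - (if u ∈ openCluster (ends '' (↑(E \ s) : Set ι)) x then (1 : ℝ) else 0)) *
        (g (openCluster (ends '' (↑(s) : Set ι)) x) - g (openCluster (ends '' (↑(E \ s) : Set ι)) x)) := by
  rw [halfRow_rootDegTwo_eq ends E he₁ he₂ hne h₁ h₂ hroot u hux Z hxZ g]
  set E' : Finset ι := (E.erase e₁).erase e₂ with hE'
  -- the pure weight
  set G : Finset ι → ℝ := fun t => g (insert x (openCluster (ends '' (↑(t) : Set ι)) u ∪ openCluster (ends '' (↑(t) : Set ι)) q)) - g {x} with hG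
  have hGnn : ∀ t, 0 ≤ G t := by
    intro t; rw [hG]; dsimp only
    exact sub_nonneg.mpr (hg (Set.singleton_subset_iff.mpr (Set.mem_insert x _)))
  -- the pure wall set and the negative mixed set
  set Pset : Finset (Finset ι) := E'.powerset.filter (fun t : Finset ι => ∀ z ∈ Z,
      z ∉ openCluster (ends '' (↑(t) : Set ι)) u ∧ z ∉ openCluster (ends '' (↑(t) : Set ι)) q) with hPset
  set Xset : Finset (Finset ι) := E'.powerset.filter (fun t : Finset ι => (∀ z ∈ Z,
      z ∉ openCluster (ends '' (↑(t) : Set ι)) u ∧ z ∉ openCluster (ends '' (↑(E' \ t) : Set ι)) q) ∧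
      u ∉ openCluster (ends '' (↑(E' \ t) : Set ι)) q) with hXset
  -- (1) the pure sum is the sum of `G` over `Pset`
  have hpure : ∑ t ∈ Pset,
      (if (u ∈ openCluster (ends '' (↑(t) : Set ι)) u ∨ u ∈ openCluster (ends '' (↑(t) : Set ι)) q) then (1 : ℝ) else 0) *
        (g (insert x (openCluster (ends '' (↑(t) : Set ι)) u ∪ openCluster (ends '' (↑(t) : Set ι)) q)) - g {x}) = ∑ t ∈ Pset, G t := by
    refine Finset.sum_congr rfl fun t _ => ?_
    rw [if_pos (Or.inl (mem_openCluster_self _ _)), one_mul]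
  -- (2) the mixed sum is at least `-Σ_{Xset} (g({x} ∪ B) − g{x})`
  have hmixed : -(∑ t ∈ Xset, (g (insert x (openCluster (ends '' (↑(E' \ t) : Set ι)) q)) - g {x})) ≤
      ∑ t ∈ E'.powerset.filter (fun t : Finset ι => ∀ z ∈ Z,
          z ∉ openCluster (ends '' (↑(t) : Set ι)) u ∧ z ∉ openCluster (ends '' (↑(E' \ t) : Set ι)) q),
      ((if u ∈ openCluster (ends '' (↑(t) : Set ι)) u then (1 : ℝ) else 0) -
          (if u ∈ openCluster (ends '' (↑(E' \ t) : Set ι)) q then (1 : ℝ) else 0)) *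
        (g (insert x (openCluster (ends '' (↑(t) : Set ι)) u)) - g (insert x (openCluster (ends '' (↑(E' \ t) : Set ι)) q))) := by
    rw [hXset, ← Finset.filter_filter, Finset.sum_filter, ← Finset.sum_neg_distrib]
    refine Finset.sum_le_sum fun t _ => ?_
    rw [if_pos (mem_openCluster_self _ _)]
    by_cases hu : u ∈ openCluster (ends '' (↑(E' \ t) : Set ι)) q
    · rw [if_pos hu, if_neg (not_not.mpr hu)]; norm_num
    · rw [if_neg hu, if_pos hu, sub_zero, one_mul, neg_sub]
      have h1 : g {x} ≤ g (insert x (openCluster (ends '' (↑(t) : Set ι)) u)) :=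
        hg (Set.singleton_subset_iff.mpr (Set.mem_insert x _))
      linarith
  -- (3) the flip: Σ_{Xset} (g({x} ∪ B) − g{x}) ≤ Σ_{Pset} G
  have hflipsum : ∑ t ∈ Xset, (g (insert x (openCluster (ends '' (↑(E' \ t) : Set ι)) q)) - g {x}) ≤ ∑ t ∈ Pset, G t := by
    -- the flip map
    have hinj : Set.InjOn (fun t => t ∆ (E'.filter (fun i => ∃ v, v ∈ openCluster (ends '' (↑(E' \ t) : Set ι)) q ∧ v ∈ ends i))) ↑Xset := by
      intro t₁ ht₁ t₂ ht₂ heq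
      rw [Finset.mem_coe, hXset, Finset.mem_filter, Finset.mem_powerset] at ht₁ ht₂
      have hM₁ : ∀ i, i ∈ (E'.filter (fun i => ∃ v, v ∈ openCluster (ends '' (↑(E' \ t₁) : Set ι)) q ∧ v ∈ ends i)) ↔
          i ∈ E' ∧ ∃ v, v ∈ openCluster (ends '' (↑(E' \ t₁) : Set ι)) q ∧ v ∈ ends i := by
        intro i; rw [Finset.mem_filter]
      have hM₂ : ∀ i, i ∈ (E'.filter (fun i => ∃ v, v ∈ openCluster (ends '' (↑(E' \ t₂) : Set ι)) q ∧ v ∈ ends i)) ↔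
          i ∈ E' ∧ ∃ v, v ∈ openCluster (ends '' (↑(E' \ t₂) : Set ι)) q ∧ v ∈ ends i := by
        intro i; rw [Finset.mem_filter]
      have heq' : t₁ ∆ (E'.filter (fun i => ∃ v, v ∈ openCluster (ends '' (↑(E' \ t₁) : Set ι)) q ∧ v ∈ ends i)) =
          t₂ ∆ (E'.filter (fun i => ∃ v, v ∈ openCluster (ends '' (↑(E' \ t₂) : Set ι)) q ∧ v ∈ ends i)) := heq
      have hM'₁ : ∀ i, i ∈ (E'.filter (fun i => ∃ v, v ∈ openCluster (ends ''
            (↑(t₁ ∆ (E'.filter (fun i => ∃ v, v ∈ openCluster (ends '' (↑(E' \ t₁) : Set ι)) q ∧ v ∈ ends i))) : Set ι)) q ∧ v ∈ ends i)) ↔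
          i ∈ E' ∧ ∃ v, v ∈ openCluster (ends ''
            (↑(t₁ ∆ (E'.filter (fun i => ∃ v, v ∈ openCluster (ends '' (↑(E' \ t₁) : Set ι)) q ∧ v ∈ ends i))) : Set ι)) q ∧ v ∈ ends i := by
        intro i; rw [Finset.mem_filter]
      have hM'₂ : ∀ i, i ∈ (E'.filter (fun i => ∃ v, v ∈ openCluster (ends ''
            (↑(t₁ ∆ (E'.filter (fun i => ∃ v, v ∈ openCluster (ends '' (↑(E' \ t₁) : Set ι)) q ∧ v ∈ ends i))) : Set ι)) q ∧ v ∈ ends i)) ↔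
          i ∈ E' ∧ ∃ v, v ∈ openCluster (ends ''
            (↑(t₂ ∆ (E'.filter (fun i => ∃ v, v ∈ openCluster (ends '' (↑(E' \ t₂) : Set ι)) q ∧ v ∈ ends i))) : Set ι)) q ∧ v ∈ ends i := by
        intro i; rw [Finset.mem_filter, heq']
      have h1 := relFlip_relFlip ends E' t₁ _ _ q ht₁.1 hM₁ hM'₁
      have h2 := relFlip_relFlip ends E' t₂ _ _ q ht₂.1 hM₂ hM'₂
      rw [← h1, ← h2, heq']
    -- it maps Xset into Pset, with `{x} ∪ B ⊆ {x} ∪ R(φ t)`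
    have hmaps : ∀ t ∈ Xset,
        (t ∆ (E'.filter (fun i => ∃ v, v ∈ openCluster (ends '' (↑(E' \ t) : Set ι)) q ∧ v ∈ ends i))) ∈ Pset ∧
        (g (insert x (openCluster (ends '' (↑(E' \ t) : Set ι)) q)) - g {x}) ≤
          G (t ∆ (E'.filter (fun i => ∃ v, v ∈ openCluster (ends '' (↑(E' \ t) : Set ι)) q ∧ v ∈ ends i))) := by
      intro t ht
      rw [hXset, Finset.mem_filter, Finset.mem_powerset] at ht
      obtain ⟨htE, hwall, huB⟩ := ht
      have hM : ∀ i, i ∈ (E'.filter (fun i => ∃ v, v ∈ openCluster (ends '' (↑(E' \ t) : Set ι)) q ∧ v ∈ ends i)) ↔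
          i ∈ E' ∧ ∃ v, v ∈ openCluster (ends '' (↑(E' \ t) : Set ι)) q ∧ v ∈ ends i := by
        intro i; rw [Finset.mem_filter]
      have hflip := openCluster_relFlip ends E' t _ q htE hM
      have hsub := openCluster_relFlip_subset ends E' t _ q u htE hM huB
      refine ⟨?_, ?_⟩
      · rw [hPset, Finset.mem_filter, Finset.mem_powerset]
        refine ⟨relFlip_subset ends E' t _ q htE hM, fun z hz => ⟨fun hzu => (hwall z hz).1 (hsub hzu), ?_⟩⟩
        rw [hflip]; exact (hwall z hz).2
      · rw [hG]; dsimp only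
        have hBsub : insert x (openCluster (ends '' (↑(E' \ t) : Set ι)) q) ⊆
            insert x (openCluster (ends '' (↑(t ∆ (E'.filter (fun i => ∃ v, v ∈ openCluster (ends '' (↑(E' \ t) : Set ι)) q ∧ v ∈ ends i))) : Set ι)) u ∪
              openCluster (ends '' (↑(t ∆ (E'.filter (fun i => ∃ v, v ∈ openCluster (ends '' (↑(E' \ t) : Set ι)) q ∧ v ∈ ends i))) : Set ι)) q) := by
          apply Set.insert_subset_insert
          rw [hflip]; exact Set.subset_union_right
        linarith [hg hBsub]
    -- assemble: Σ_X ≤ Σ_X G∘φ = Σ_{φ X} G ≤ Σ_P G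
    calc ∑ t ∈ Xset, (g (insert x (openCluster (ends '' (↑(E' \ t) : Set ι)) q)) - g {x})
        ≤ ∑ t ∈ Xset, G (t ∆ (E'.filter (fun i => ∃ v, v ∈ openCluster (ends '' (↑(E' \ t) : Set ι)) q ∧ v ∈ ends i))) :=
          Finset.sum_le_sum fun t ht => (hmaps t ht).2
      _ = ∑ t'' ∈ Xset.image (fun t => t ∆ (E'.filter (fun i => ∃ v, v ∈ openCluster (ends '' (↑(E' \ t) : Set ι)) q ∧ v ∈ ends i))), G t'' :=
          (Finset.sum_image (fun t₁ ht₁ t₂ ht₂ h => hinj (Finset.mem_coe.mpr ht₁) (Finset.mem_coe.mpr ht₂) h)).symm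
      _ ≤ ∑ t ∈ Pset, G t := by
          apply Finset.sum_le_sum_of_subset_of_nonneg
          · intro t'' ht''
            rw [Finset.mem_image] at ht''
            obtain ⟨t, ht, rfl⟩ := ht''
            exact (hmaps t ht).1
          · exact fun t _ _ => hGnn t
  rw [hpure]
  linarith

end main

end Coefficientwise

end Summit.CriticalPhenomena.PercolationContinuityZ3.Theorems
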